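import Mathlib
import Summits.Ventures.PercRepro2.Defs
import Summits.Ventures.PercRepro2.Independence
import Summits.Ventures.PercRepro2.Harris
import Summits.Ventures.PercRepro2.Graph
import Summits.Ventures.PercRepro2.Exploration
import Summits.Ventures.PercRepro2.Events
import Summits.Ventures.PercRepro2.Induced

/-!
# Row 2′CON-W, the prover target (VTX): one new vertex of any degree keeps the centred rung
(blind cell PercRepro2, typer-1; mine-c g6 MINE-C.md v3.0 §13 "(VTX): adding ONE new vertex of ANY
degree (any attachment weights) keeps `E_{H+z}[(X_H − m)(Y_H − m); s ↛_{H+z} T] ≥ 0`"; lead g11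
16:19:58Z "row 2′CON-W PROMOTED … prover target of the row = (VTX)")

**The vocabulary.** `G = (V, E, ends)` is the graph WITH the new vertex `z`; `H = G − z` is the
deleted configuration `delConfig ends {z} ω` (every edge at `z` closed, same probability space —
`Induced.lean`), so the `H`-events are the preimages `delEvent ends z A = {ω | delConfig ends {z} ω ∈ A}`:
`X_H = delEvent z {a ∈ C(s)}`, `R_T^H = delEvent z R_T`; the `G`-avoidance `R_T^G = {s ↛_{H+z} T}` is
the plain `avoidAll ends s T`. `conn_iff_del` is the structure lemma: for `s, t ≠ z`,
`s ↔_G t ↔ s ↔_H t ∨ (C_H(s) hits N(z) ∧ C_H(t) hits N(z))`, `N(z)` = the open neighbourhood of `z`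
— the random-`W` version of `Contract.conn_contract_iff` (so (VTX) is (CON-W) averaged over
`W = N(z)`, and (CON-W) is (VTX) with `z` joined to `W` by weight-1 edges).

* **`VTX`** (cleared by `P(R_T^H)²`, `H`-centring `m = E_H[· | R_T^H]`):
  `P(R_T^H)² P(X_H Y_H; R_T^G) − P(R_T^H) [P(X_H; R_T^H) P(Y_H; R_T^G) + P(Y_H; R_T^H) P(X_H; R_T^G)]
   + P(X_H; R_T^H) P(Y_H; R_T^H) P(R_T^G) ≥ 0`;
* **`VTX_all`**: over all finite graphs, admissible weights, `z`, `s ≠ z`, `z ∉ T`, `s ∉ T`, markers.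

Census: mine-c §13 + engine D84 (two implementations, `n = 6` FULL, ties digit for digit).
-/

namespace Summit.Ventures.PercRepro2

namespace NewVertex

variable {V : Type*} {E : Type*}

/-! ## `H = G − z` on the same space -/

section Del

variable (ends : E → Sym2 V) (z : V)

/-- The `H`-event attached to a `G`-event: `{ω | ω with every edge at z closed ∈ A}`. -/
def delEvent (A : Set (Config E)) : Set (Config E) := {ω | delConfig ends {z} ω ∈ A}

variable {ends z}

/-- Closing the edges at `z` only lowers the configuration. -/
lemma delConfig_singleton_le (ω : Config E) : delConfig ends {z} ω ≤ ω := by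
  intro e
  by_cases h : e ∈ touches ends {z}
  · rw [delConfig_apply_of_mem h]; exact Bool.false_le _
  · rw [delConfig_apply_of_notMem h]

/-- `z` is isolated in `H`: nothing else is connected to it. -/
lemma eq_of_conn_delConfig {ω : Config E} {x : V} (h : Conn ends (delConfig ends {z} ω) x z) :
    x = z := by
  by_contra hx
  have hS : ∀ y ∈ ({y | y ≠ z} : Set V), ∀ y',
      (openGraph ends (delConfig ends {z} ω)).Adj y y' → y' ∈ ({y | y ≠ z} : Set V) := by
    intro y _ y' hyy'
    obtain ⟨_, e, he, hends⟩ := openGraph_adj.1 hyy'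
    intro hy'
    subst hy'
    have : e ∈ touches ends {y'} := mem_touches_of_ends hends (Or.inr (Set.mem_singleton _))
    rw [delConfig_apply_of_mem this] at he
    exact Bool.false_ne_true he
  exact (mem_of_conn_of_closed hS hx h) rfl

/-- An open edge of `H` is an open edge of `G` not at `z`. -/
lemma openAdj_of_openAdj_delConfig {ω : Config E} {x y : V}
    (h : OpenAdj ends (delConfig ends {z} ω) x y) : OpenAdj ends ω x y ∧ x ≠ z ∧ y ≠ z := by
  obtain ⟨e, he, hends⟩ := h
  by_cases ht : e ∈ touches ends {z}
  · rw [delConfig_apply_of_mem ht] at he; exact absurd he Bool.false_ne_true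
  · rw [delConfig_apply_of_notMem ht] at he
    refine ⟨⟨e, he, hends⟩, ?_, ?_⟩
    · rintro rfl; exact ht (mem_touches_of_ends hends (Or.inl (Set.mem_singleton _)))
    · rintro rfl; exact ht (mem_touches_of_ends hends (Or.inr (Set.mem_singleton _)))

/-- An open edge of `G` not at `z` is an open edge of `H`. -/
lemma openAdj_delConfig_of_openAdj {ω : Config E} {x y : V} (h : OpenAdj ends ω x y) (hx : x ≠ z)
    (hy : y ≠ z) : OpenAdj ends (delConfig ends {z} ω) x y := by
  obtain ⟨e, he, hends⟩ := h
  refine ⟨e, ?_, hends⟩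
  have ht : e ∉ touches ends {z} := by
    rintro ⟨v, hv, v', hvv'⟩
    rw [Set.mem_singleton_iff] at hv
    subst hv
    rw [hends, Sym2.eq_iff] at hvv'
    rcases hvv' with ⟨h1, _⟩ | ⟨_, h2⟩
    · exact hx h1
    · exact hy h2
  rw [delConfig_apply_of_notMem ht]
  exact he

/-- **Connections in `G = H + z`** (the random-`W` form of `Contract.conn_contract_iff`): for
`s, t ≠ z`, `s ↔_G t ↔ s ↔_H t ∨ (C_H(s) hits N(z) ∧ C_H(t) hits N(z))`, where `N(z)` is the open
neighbourhood of `z` in `ω`. -/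
theorem conn_iff_del {ω : Config E} {s t : V} (hs : s ≠ z) (ht : t ≠ z) :
    Conn ends ω s t ↔
      Conn ends (delConfig ends {z} ω) s t ∨
        ((∃ w, OpenAdj ends ω z w ∧ Conn ends (delConfig ends {z} ω) s w) ∧
          ∃ w, OpenAdj ends ω z w ∧ Conn ends (delConfig ends {z} ω) w t) := by
  constructor
  · intro h
    -- `hitsS`: the `H`-cluster of `s` meets the open neighbourhood of `z`
    let hitsS : Prop := ∃ w, OpenAdj ends ω z w ∧ Conn ends (delConfig ends {z} ω) s w
    let S : Set V := {y | Conn ends (delConfig ends {z} ω) s y ∨ (y = z ∧ hitsS) ∨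
      (hitsS ∧ ∃ w, OpenAdj ends ω z w ∧ Conn ends (delConfig ends {z} ω) w y)}
    have hS : ∀ y ∈ S, ∀ y', (openGraph ends ω).Adj y y' → y' ∈ S := by
      intro y hy y' hyy'
      obtain ⟨hne, hadj⟩ := openGraph_adj.1 hyy'
      by_cases hy'z : y' = z
      · -- the step enters `z`: `y` is a neighbour of `z`
        subst hy'z
        have hyz : y ≠ y' := hne
        have hadj' : OpenAdj ends ω y' y := hadj.symm
        refine Or.inr (Or.inl ⟨rfl, ?_⟩)
        rcases hy with hy | ⟨hyz', _⟩ | ⟨hits, _⟩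
        · exact ⟨y, hadj', hy⟩
        · exact absurd hyz' hyz
        · exact hits
      · by_cases hyz : y = z
        · -- the step leaves `z`: `y'` is a neighbour of `z`
          subst hyz
          have hits : hitsS := by
            rcases hy with hy | ⟨_, hits⟩ | ⟨hits, _⟩
            · exact absurd (eq_of_conn_delConfig hy) hs
            · exact hits
            · exact hits
          exact Or.inr (Or.inr ⟨hits, y', hadj, conn_refl _ _ _⟩)
        · -- an `H`-edge
          have hH : Conn ends (delConfig ends {z} ω) y y' :=
            conn_of_openAdj (openAdj_delConfig_of_openAdj hadj hyz hy'z)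
          rcases hy with hy | ⟨hyz', _⟩ | ⟨hits, w, hw, hwy⟩
          · exact Or.inl (conn_trans hy hH)
          · exact absurd hyz' hyz
          · exact Or.inr (Or.inr ⟨hits, w, hw, conn_trans hwy hH⟩)
    have hmem : t ∈ S := mem_of_conn_of_closed hS (Or.inl (conn_refl _ _ _)) h
    rcases hmem with hc | ⟨htz, _⟩ | ⟨hits, w, hw, hwt⟩
    · exact Or.inl hc
    · exact absurd htz ht
    · exact Or.inr ⟨hits, w, hw, hwt⟩
  · rintro (h | ⟨⟨w₁, hw₁, hs₁⟩, w₂, hw₂, ht₂⟩)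
    · exact conn_mono (delConfig_singleton_le ω) h
    · exact conn_trans (conn_mono (delConfig_singleton_le ω) hs₁)
        (conn_trans (conn_symm (conn_of_openAdj hw₁))
          (conn_trans (conn_of_openAdj hw₂) (conn_mono (delConfig_singleton_le ω) ht₂)))

/-- The `G`-avoidance is contained in the `H`-avoidance. -/
lemma avoidAll_subset_delEvent (s : V) (T : Finset V) :
    avoidAll ends s T ⊆ delEvent ends z (avoidAll ends s T) := by
  intro ω h t ht hc
  exact h t ht (conn_mono (delConfig_singleton_le ω) hc)

end Del

/-! ## The row -/

section Row

variable [Fintype E] [DecidableEq E] [DecidableEq V] {R : Type*} [Field R] [LinearOrder R]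

variable (p : E → R) (ends : E → Sym2 V) (z s : V) (T : Finset V) (a b : V)

/-- **(VTX)** (mine-c §13), cleared by `P(R_T^H)²`, `H = G − z`: with `X_H = {a ∈ C_H(s)}`,
`Y_H = {b ∈ C_H(s)}`, `R_T^H = {s ↮_H T}` and the `G`-avoidance `R_T^G = {s ↮_G T}`,
`E_H[(X_H − m_X)(Y_H − m_Y); R_T^G] ≥ 0`, i.e.
`P(R_T^H)² P(X_H Y_H; R_T^G) − P(R_T^H) [P(X_H; R_T^H) P(Y_H; R_T^G) + P(Y_H; R_T^H) P(X_H; R_T^G)]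
 + P(X_H; R_T^H) P(Y_H; R_T^H) P(R_T^G) ≥ 0`. -/
def VTX : Prop :=
  0 ≤ prob p (delEvent ends z (avoidAll ends s T)) ^ 2 *
        prob p (delEvent ends z (connAll ends s ({a} ∪ {b})) ∩ avoidAll ends s T) -
      prob p (delEvent ends z (avoidAll ends s T)) *
        (prob p (delEvent ends z (avoidAll ends s T ∩ connAll ends s {a})) *
            prob p (delEvent ends z (connAll ends s {b}) ∩ avoidAll ends s T) +
          prob p (delEvent ends z (avoidAll ends s T ∩ connAll ends s {b})) *
            prob p (delEvent ends z (connAll ends s {a}) ∩ avoidAll ends s T)) +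
      prob p (delEvent ends z (avoidAll ends s T ∩ connAll ends s {a})) *
        prob p (delEvent ends z (avoidAll ends s T ∩ connAll ends s {b})) *
        prob p (avoidAll ends s T)

end Row

section Closure

variable (R : Type*) [Field R] [LinearOrder R] [IsStrictOrderedRing R]

/-- **(VTX)** over all finite graphs, admissible weights, new vertex `z`, root `s ≠ z`, avoided set
`T ∌ z, s`, and markers `a, b` (any degree of `z`, any attachment weights: they are part of `p`). -/
def VTX_all : Prop :=
  ∀ (V E : Type) [Fintype V] [DecidableEq V] [Fintype E] [DecidableEq E]
    (ends : E → Sym2 V) (p : E → R), IsProbVec p →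
    ∀ (z s : V) (T : Finset V) (a b : V), s ≠ z → z ∉ T → s ∉ T → VTX p ends z s T a b

end Closure

end NewVertex

end Summit.Ventures.PercRepro2
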